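import Summits.Ventures.PercRepro.S2NuFourTools

/-!
# PercRepro — S2: THE `5`- AND `6`-SUBSETS OF RANK `≤ 3` AGAINST THE DEPENDENT `4`-SUBSETS (p7, gen 17; sub-claim S2; for the
concentrated cases of the cells `(13, 8 …)`)

Inside any `W ⊆ E` of an `e`-free core whose lines carry `≤ 3` points: a `5`-subset `T` of rank `≤ 3` has five dependent
`4`-subsets, and a dependent `4`-subset `Q` (of rank exactly `3`) lies in at most `2` such `T` (`T = Q ∪ {x}` with `x ∈ cl Q ∩ W ∖ Q`,
the plane `cl Q` having `≤ 6` points) — **`ncard_five_eRk_le_three_mul_five_le`**: `5·R₅³(W) ≤ 2·Dep₄(W)`; a `6`-subset of rank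
`≤ 3` has fifteen dependent `4`-subsets and a dependent `4`-subset lies in at most one (`T = Q ∪ (cl Q ∩ W ∖ Q)`, two points) —
**`ncard_six_eRk_le_three_mul_fifteen_le`**: `15·R₆³(W) ≤ Dep₄(W)`. With `Dep₄(W) ≤ I₃(W)` (S2NuFourTools) these bound the crude
classes of the refined contraction counts. Axioms: standard.
-/

open scoped Matroid

namespace PercRepro

namespace S2

open Set

variable {α : Type}

/-- A dependent `4`-subset of `W` (lines `≤ 3` points) has rank exactly `3`, and a point `x ∈ W ∖ Q` with `ρ(Q ∪ {x}) ≤ 3` lies in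
`cl Q`; the points of `cl Q ∩ W ∖ Q` number at most `2`. -/
theorem ncard_closure_inter_sdiff_le_two_of_dep_four (M : Matroid α) [M.Finite]
    (hfree : ∀ e ∈ M.E, ∃ A ⊆ M.E \ {e}, e ∉ M.closure A ∧ e ∉ M.closure ((M.E \ {e}) \ A))
    (hs : ∀ e ∈ M.E, ∀ f ∈ M.E, e ≠ f → M.eRk {e, f} = 2)
    (hC1 : ∀ L ⊆ M.E, M.eRk L = 2 → L.ncard ≤ 3) {W : Set α} (hW : W ⊆ M.E)
    {Q : Set α} (hQW : Q ⊆ W) (hQ4 : Q.ncard = 4) (hQdep : M.Dep Q) :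
    M.eRk Q = 3 ∧ ((M.closure Q ∩ W) \ Q).ncard ≤ 2 := by
  classical
  have hEfin := M.ground_finite
  have hQE : Q ⊆ M.E := hQW.trans hW
  have hQfin : Q.Finite := hEfin.subset hQE
  have hr3 : M.eRk Q = 3 := by
    have hlt : M.eRk Q < 4 := by
      have := (Matroid.eRk_lt_encard_iff_dep_of_finite hQfin hQE).2 hQdep
      rwa [← hQfin.cast_ncard_eq, hQ4] at this
    have hle : M.eRk Q ≤ 3 := by
      have h : M.eRk Q < (3 : ℕ∞) + 1 := by
        rw [show (3 : ℕ∞) + 1 = 4 by norm_num]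
        exact hlt
      exact Order.le_of_lt_add_one h
    refine le_antisymm hle ?_
    by_contra hlt3
    push Not at hlt3
    have h2 : M.eRk Q ≤ 2 := by
      have h : M.eRk Q < (2 : ℕ∞) + 1 := by
        rw [show (2 : ℕ∞) + 1 = 3 by norm_num]
        exact hlt3
      exact Order.le_of_lt_add_one h
    have h0 := ncard_four_eRk_le_two_eq_zero M hs hC1 hW
    rw [Set.ncard_eq_zero (hEfin.finite_subsets.subset (fun T hT => hT.1.trans hW))] at h0
    exact Set.eq_empty_iff_forall_notMem.1 h0 Q ⟨hQW, hQ4, h2⟩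
  refine ⟨hr3, ?_⟩
  have hcl : M.closure Q ⊆ M.E := M.closure_subset_ground Q
  have hclfin : (M.closure Q).Finite := hEfin.subset hcl
  have hr : M.eRk (M.closure Q) ≤ 3 := by rw [M.eRk_closure_eq, hr3]
  have h6 := ThmN.ncard_le_six_of_eRk_le_three_of_free M hfree hcl hr
  have hQcl : Q ⊆ M.closure Q := M.subset_closure Q hQE
  have hsub : (M.closure Q ∩ W) \ Q ⊆ M.closure Q \ Q := Set.sdiff_subset_sdiff_left Set.inter_subset_left
  have h1 := Set.ncard_le_ncard hsub hclfin.sdiff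
  have h2 := Set.ncard_sdiff_add_ncard_of_subset hQcl hclfin
  omega

/-- **`5·R₅³(W) ≤ 2·Dep₄(W)`**: the `5`-subsets of `W` of rank `≤ 3` against its dependent `4`-subsets. -/
theorem ncard_five_eRk_le_three_mul_five_le (M : Matroid α) [M.Finite]
    (hfree : ∀ e ∈ M.E, ∃ A ⊆ M.E \ {e}, e ∉ M.closure A ∧ e ∉ M.closure ((M.E \ {e}) \ A))
    (hs : ∀ e ∈ M.E, ∀ f ∈ M.E, e ≠ f → M.eRk {e, f} = 2)
    (hC1 : ∀ L ⊆ M.E, M.eRk L = 2 → L.ncard ≤ 3) {W : Set α} (hW : W ⊆ M.E) :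
    {T : Set α | T ⊆ W ∧ T.ncard = 5 ∧ M.eRk T ≤ 3}.ncard * 5 ≤ {Q : Set α | Q ⊆ W ∧ Q.ncard = 4 ∧ M.Dep Q}.ncard * 2 := by
  classical
  have hEfin := M.ground_finite
  have hWfin : W.Finite := hEfin.subset hW
  set Wf : Finset α := hWfin.toFinset with hWf
  have hWfc : (Wf : Set α) = W := Set.Finite.coe_toFinset _
  set s : Finset (Set α) := (Matroid.subsF Wf 5).filter (fun T => M.eRk T ≤ 3) with hsdef
  set t : Finset (Set α) := (Matroid.subsF Wf 4).filter (fun Q => M.Dep Q) with htdef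
  have hmem_s : ∀ T, T ∈ s ↔ T ⊆ W ∧ T.ncard = 5 ∧ M.eRk T ≤ 3 := by
    intro T
    rw [hsdef, Finset.mem_filter, mem_subsF_iff, hWfc]
    tauto
  have hmem_t : ∀ Q, Q ∈ t ↔ Q ⊆ W ∧ Q.ncard = 4 ∧ M.Dep Q := by
    intro Q
    rw [htdef, Finset.mem_filter, mem_subsF_iff, hWfc]
    tauto
  have hcard_s : {T : Set α | T ⊆ W ∧ T.ncard = 5 ∧ M.eRk T ≤ 3}.ncard = s.card := by
    rw [← Set.ncard_coe_finset s]
    congr 1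
    ext T
    rw [Finset.mem_coe, hmem_s]
    rfl
  have hcard_t : {Q : Set α | Q ⊆ W ∧ Q.ncard = 4 ∧ M.Dep Q}.ncard = t.card := by
    rw [← Set.ncard_coe_finset t]
    congr 1
    ext Q
    rw [Finset.mem_coe, hmem_t]
    rfl
  rw [hcard_s, hcard_t]
  refine Finset.card_mul_le_card_mul (fun (T : Set α) (Q : Set α) => Q ⊆ T) ?_ ?_
  · -- every `4`-subset of `T` is dependent: `5` of them below `T`
    intro T hT
    obtain ⟨hTW, hT5, hTr⟩ := (hmem_s T).1 hT
    have hTfin : T.Finite := hWfin.subset hTW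
    have hsub : {Q : Set α | Q ⊆ T ∧ Q.ncard = 4} ⊆
        ((t.bipartiteAbove (fun (T : Set α) (Q : Set α) => Q ⊆ T) T : Finset (Set α)) : Set (Set α)) := by
      rintro Q ⟨hQT, hQ4⟩
      rw [Finset.mem_coe, Finset.mem_bipartiteAbove, hmem_t]
      refine ⟨⟨hQT.trans hTW, hQ4, ?_⟩, hQT⟩
      have hQfin : Q.Finite := hTfin.subset hQT
      rw [← Matroid.eRk_lt_encard_iff_dep_of_finite hQfin ((hQT.trans hTW).trans hW), ← hQfin.cast_ncard_eq, hQ4]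
      calc M.eRk Q ≤ M.eRk T := M.eRk_mono hQT
        _ ≤ 3 := hTr
        _ < ((4 : ℕ) : ℕ∞) := by norm_num
    have h := Set.ncard_le_ncard hsub (Finset.finite_toSet _)
    rw [Set.ncard_coe_finset, ncard_subsets_ncard_eq T hTfin 4, hT5] at h
    exact h
  · -- a dependent `4`-subset lies in at most `2` such `5`-subsets
    intro Q hQ
    obtain ⟨hQW, hQ4, hQdep⟩ := (hmem_t Q).1 hQ
    obtain ⟨hr3, hcl2⟩ := ncard_closure_inter_sdiff_le_two_of_dep_four M hfree hs hC1 hW hQW hQ4 hQdep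
    have hQfin : Q.Finite := hWfin.subset hQW
    have hclfin : ((M.closure Q ∩ W) \ Q).Finite := (hWfin.subset Set.inter_subset_right).sdiff
    have hsub : ((s.bipartiteBelow (fun (T : Set α) (Q : Set α) => Q ⊆ T) Q : Finset (Set α)) : Set (Set α)) ⊆
        {T : Set α | T ⊆ W ∧ T.ncard = 5 ∧ Q ⊆ T ∧ M.eRk T ≤ 3} := by
      intro T hT
      rw [Finset.mem_coe, Finset.mem_bipartiteBelow] at hT
      obtain ⟨hTs, hQT⟩ := hT
      obtain ⟨hTW, hT5, hTr⟩ := (hmem_s T).1 hTs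
      exact ⟨hTW, hT5, hQT, hTr⟩
    have h := Set.ncard_le_ncard hsub (hWfin.finite_subsets.subset (fun T hT => hT.1))
    rw [Set.ncard_coe_finset] at h
    refine h.trans ?_
    -- `T ↦ T ∖ Q` into the `1`-subsets of `cl Q ∩ W ∖ Q`
    have hinj : {T : Set α | T ⊆ W ∧ T.ncard = 5 ∧ Q ⊆ T ∧ M.eRk T ≤ 3}.ncard ≤
        {X : Set α | X ⊆ (M.closure Q ∩ W) \ Q ∧ X.ncard = 1}.ncard := by
      refine Set.ncard_le_ncard_of_injOn (fun T => T \ Q) ?_ ?_ (hclfin.finite_subsets.subset (fun X hX => hX.1))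
      · rintro T ⟨hTW, hT5, hQT, hTr⟩
        have hTfin : T.Finite := hWfin.subset hTW
        refine ⟨?_, ?_⟩
        · rintro x ⟨hxT, hxQ⟩
          refine ⟨⟨?_, hTW hxT⟩, hxQ⟩
          -- `x ∈ cl Q`: otherwise `ρ(Q ∪ {x}) = 4 > 3 ≥ ρ T`
          by_contra hxcl
          have hxE : x ∈ M.E := hW (hTW hxT)
          have h := M.eRk_insert_eq_add_one (X := Q) (e := x) ⟨hxE, hxcl⟩
          have hle : M.eRk (insert x Q) ≤ M.eRk T := M.eRk_mono (Set.insert_subset hxT hQT)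
          rw [h, hr3] at hle
          have : (4 : ℕ∞) ≤ 3 := le_trans (by norm_num) (hle.trans hTr)
          exact absurd this (by norm_num)
        · rw [Set.ncard_sdiff hQT hQfin, hT5, hQ4]
      · rintro T₁ ⟨-, -, h1, -⟩ T₂ ⟨-, -, h2, -⟩ hEq
        have e1 := Set.union_sdiff_cancel h1
        have e2 := Set.union_sdiff_cancel h2
        simp only at hEq
        rw [← e1, ← e2, hEq]
    refine hinj.trans ?_
    rw [ncard_subsets_ncard_eq _ hclfin 1, Nat.choose_one_right]
    exact hcl2

/-- **`15·R₆³(W) ≤ Dep₄(W)`**: the `6`-subsets of `W` of rank `≤ 3` against its dependent `4`-subsets. -/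
theorem ncard_six_eRk_le_three_mul_fifteen_le (M : Matroid α) [M.Finite]
    (hfree : ∀ e ∈ M.E, ∃ A ⊆ M.E \ {e}, e ∉ M.closure A ∧ e ∉ M.closure ((M.E \ {e}) \ A))
    (hs : ∀ e ∈ M.E, ∀ f ∈ M.E, e ≠ f → M.eRk {e, f} = 2)
    (hC1 : ∀ L ⊆ M.E, M.eRk L = 2 → L.ncard ≤ 3) {W : Set α} (hW : W ⊆ M.E) :
    {T : Set α | T ⊆ W ∧ T.ncard = 6 ∧ M.eRk T ≤ 3}.ncard * 15 ≤ {Q : Set α | Q ⊆ W ∧ Q.ncard = 4 ∧ M.Dep Q}.ncard * 1 := by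
  classical
  have hEfin := M.ground_finite
  have hWfin : W.Finite := hEfin.subset hW
  set Wf : Finset α := hWfin.toFinset with hWf
  have hWfc : (Wf : Set α) = W := Set.Finite.coe_toFinset _
  set s : Finset (Set α) := (Matroid.subsF Wf 6).filter (fun T => M.eRk T ≤ 3) with hsdef
  set t : Finset (Set α) := (Matroid.subsF Wf 4).filter (fun Q => M.Dep Q) with htdef
  have hmem_s : ∀ T, T ∈ s ↔ T ⊆ W ∧ T.ncard = 6 ∧ M.eRk T ≤ 3 := by
    intro T
    rw [hsdef, Finset.mem_filter, mem_subsF_iff, hWfc]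
    tauto
  have hmem_t : ∀ Q, Q ∈ t ↔ Q ⊆ W ∧ Q.ncard = 4 ∧ M.Dep Q := by
    intro Q
    rw [htdef, Finset.mem_filter, mem_subsF_iff, hWfc]
    tauto
  have hcard_s : {T : Set α | T ⊆ W ∧ T.ncard = 6 ∧ M.eRk T ≤ 3}.ncard = s.card := by
    rw [← Set.ncard_coe_finset s]
    congr 1
    ext T
    rw [Finset.mem_coe, hmem_s]
    rfl
  have hcard_t : {Q : Set α | Q ⊆ W ∧ Q.ncard = 4 ∧ M.Dep Q}.ncard = t.card := by
    rw [← Set.ncard_coe_finset t]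
    congr 1
    ext Q
    rw [Finset.mem_coe, hmem_t]
    rfl
  rw [hcard_s, hcard_t]
  refine Finset.card_mul_le_card_mul (fun (T : Set α) (Q : Set α) => Q ⊆ T) ?_ ?_
  · intro T hT
    obtain ⟨hTW, hT6, hTr⟩ := (hmem_s T).1 hT
    have hTfin : T.Finite := hWfin.subset hTW
    have hsub : {Q : Set α | Q ⊆ T ∧ Q.ncard = 4} ⊆
        ((t.bipartiteAbove (fun (T : Set α) (Q : Set α) => Q ⊆ T) T : Finset (Set α)) : Set (Set α)) := by
      rintro Q ⟨hQT, hQ4⟩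
      rw [Finset.mem_coe, Finset.mem_bipartiteAbove, hmem_t]
      refine ⟨⟨hQT.trans hTW, hQ4, ?_⟩, hQT⟩
      have hQfin : Q.Finite := hTfin.subset hQT
      rw [← Matroid.eRk_lt_encard_iff_dep_of_finite hQfin ((hQT.trans hTW).trans hW), ← hQfin.cast_ncard_eq, hQ4]
      calc M.eRk Q ≤ M.eRk T := M.eRk_mono hQT
        _ ≤ 3 := hTr
        _ < ((4 : ℕ) : ℕ∞) := by norm_num
    have h := Set.ncard_le_ncard hsub (Finset.finite_toSet _)
    rw [Set.ncard_coe_finset, ncard_subsets_ncard_eq T hTfin 4, hT6] at h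
    exact h
  · intro Q hQ
    obtain ⟨hQW, hQ4, hQdep⟩ := (hmem_t Q).1 hQ
    obtain ⟨hr3, hcl2⟩ := ncard_closure_inter_sdiff_le_two_of_dep_four M hfree hs hC1 hW hQW hQ4 hQdep
    have hQfin : Q.Finite := hWfin.subset hQW
    have hclfin : ((M.closure Q ∩ W) \ Q).Finite := (hWfin.subset Set.inter_subset_right).sdiff
    have hsub : ((s.bipartiteBelow (fun (T : Set α) (Q : Set α) => Q ⊆ T) Q : Finset (Set α)) : Set (Set α)) ⊆
        {T : Set α | T ⊆ W ∧ T.ncard = 6 ∧ Q ⊆ T ∧ M.eRk T ≤ 3} := by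
      intro T hT
      rw [Finset.mem_coe, Finset.mem_bipartiteBelow] at hT
      obtain ⟨hTs, hQT⟩ := hT
      obtain ⟨hTW, hT6, hTr⟩ := (hmem_s T).1 hTs
      exact ⟨hTW, hT6, hQT, hTr⟩
    have h := Set.ncard_le_ncard hsub (hWfin.finite_subsets.subset (fun T hT => hT.1))
    rw [Set.ncard_coe_finset] at h
    refine h.trans ?_
    have hinj : {T : Set α | T ⊆ W ∧ T.ncard = 6 ∧ Q ⊆ T ∧ M.eRk T ≤ 3}.ncard ≤
        {X : Set α | X ⊆ (M.closure Q ∩ W) \ Q ∧ X.ncard = 2}.ncard := by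
      refine Set.ncard_le_ncard_of_injOn (fun T => T \ Q) ?_ ?_ (hclfin.finite_subsets.subset (fun X hX => hX.1))
      · rintro T ⟨hTW, hT6, hQT, hTr⟩
        have hTfin : T.Finite := hWfin.subset hTW
        refine ⟨?_, ?_⟩
        · rintro x ⟨hxT, hxQ⟩
          refine ⟨⟨?_, hTW hxT⟩, hxQ⟩
          by_contra hxcl
          have hxE : x ∈ M.E := hW (hTW hxT)
          have h := M.eRk_insert_eq_add_one (X := Q) (e := x) ⟨hxE, hxcl⟩
          have hle : M.eRk (insert x Q) ≤ M.eRk T := M.eRk_mono (Set.insert_subset hxT hQT)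
          rw [h, hr3] at hle
          have : (4 : ℕ∞) ≤ 3 := le_trans (by norm_num) (hle.trans hTr)
          exact absurd this (by norm_num)
        · rw [Set.ncard_sdiff hQT hQfin, hT6, hQ4]
      · rintro T₁ ⟨-, -, h1, -⟩ T₂ ⟨-, -, h2, -⟩ hEq
        have e1 := Set.union_sdiff_cancel h1
        have e2 := Set.union_sdiff_cancel h2
        simp only at hEq
        rw [← e1, ← e2, hEq]
    refine hinj.trans ?_
    rw [ncard_subsets_ncard_eq _ hclfin 2]
    exact (Nat.choose_le_choose 2 hcl2).trans (by norm_num)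

end S2

end PercRepro
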